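import Mathlib
import HarnessLib
import HarnessLib.Audit
import Summits.MatrixMultiplication.Statement
import Literature.Computability.AlgebraicComplexity.GroupTheoreticMatMulProofs
import Literature.Computability.AlgebraicComplexity.FlatteningBound
import Literature.RepresentationTheory.FiniteGroups.CharacterDegrees
import Summits.MatrixMultiplication.MatrixMultiplication.Theorems.AsymptoticRankCWOmegaGeTwo
import HarnessLib.Audit.Status.Attr

/-!
Route: GroupTheoreticSTPP

X_C (group-theoretic / STPP packing form): for every ε > 0 there is a finite abelian group H and an
STPP construction
(A_i, B_i, C_i)_{i<N} in H (simultaneous triple product property, CohnKleinbergSzegedyUmans2005 Def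
5.1 =
BlasiakChurchCohnGrochowNaslundSawinUmans2017 Def 2.2, written additively: s'−s + t'−t + u'−u = 0
with s∈A_k, s'∈A_i,
t∈B_i, t'∈B_j, u∈C_j, u'∈C_k forces i=j=k, s=s', t=t', u=u') whose packing beats |H| at exponent
(2+ε)/3:
Σ_i (|A_i||B_i||C_i|)^{(2+ε)/3} > |H|.
With the fundamental inequality Σ_i (|A_i||B_i||C_i|)^{ω/3} ≤ |H| for abelian H (CKSU2005 Thm 5.5;
BCCGNSU2017 (1.1)) and
monotonicity of τ ↦ Σ x_i^{τ/3}, X_C gives ω < 2+ε for every ε, hence ω(ℂ) = 2. By BCCGNSU2017 Thm B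
the groups H must have
unbounded exponent as ε → 0 (cyclic / p^k-torsion groups remain viable); CKSU2005 Conj 4.7 ("two
families") is a special
case of X_C.

Lean (elaborates, SketchC.lean; STPP inlined, no new definition needed):
∀ ε : ℝ, 0 < ε → ∃ (H : Type) (_ : AddCommGroup H) (_ : Fintype H) (N : ℕ) (A B C : Fin N → Finset
H), (∀ i j k : Fin N, ∀ s ∈ A k, ∀ s' ∈ A i, ∀ t ∈ B i, ∀ t' ∈ B j, ∀ u ∈ C j, ∀ u' ∈ C k, (s' - s)
+ (t' - t) + (u' - u) = 0 → i = j ∧ j = k ∧ s = s' ∧ t = t' ∧ u = u') ∧ (Fintype.card H : ℝ) < ∑ i,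
(((A i).card * (B i).card * (C i).card : ℕ) : ℝ) ^ ((2 + ε) / 3)

Rationale: WHY THIS LINE (widen: finite-group representation theory + additive combinatorics). CohnUmans2003
embed matrix product into group algebras ℂ[G]; CohnKleinbergSzegedyUmans2005 (arXiv:math/0511460)
reach ω < 2.41 this way and state two conjectures each implying ω = 2 (Conj 3.4 strong USP; Conj 4.7
two families). All constructions factor through STPP families in a group H with
Σ(|A_i||B_i||C_i|)^{ω/3} ≤ Σ_k d_k^ω (CKSU Thm 5.5), = |H| for abelian H — so the abelian thesis X_C
is purely additive-combinatorial and elaborates over Mathlib (Finset in an AddCommGroup). The area's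
own kill technology is imported too: slice rank / tricolored sum-free sets (Croot–Lev–Pach,
Ellenberg–Gijswijt, Tao) refute Conj 3.4 and every bounded-exponent abelian attempt
(BlasiakChurchCohnGrochowNaslundSawinUmans2017 = arXiv:1605.06702, Thm A, Thm B; Thm B is PROVED in
tree: BlasiakChurchCohnGrochowNaslundSawinUmans2017_B_holds), and representation theory bars finite
groups of Lie type and subgroups with large normalisers (BlasiakCohnGrochowPrattUmans2023 =
arXiv:2204.03826, §3, Thm 3.6). What survives: abelian groups of unbounded exponent (cyclic groups:
Behrend-type sets defeat slice rank there) and non-abelian groups with slowly growing character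
degrees. DECIDING THEOREM (rev 3, route-repair 2026-08-15): `closes : CThesis →
MatrixMultiplication` is PROVED in the route file from tree theorems only — CKSU Thm 5.5, abelian
case (Literature.Computability.AlgebraicComplexity.CohnKleinbergSzegedyUmans2005_5_5_abelian_holds,
discharged via Schönhage's asymptotic sum inequality) applied with ε := ω − 2, and ω ≥ 2
(omega_two_le, the flattening bound); no Literature fact is assumed, so the target X_C alone decides
ω(ℂ) = 2.

RANKED CRUXES.
#2 CPackingConstruction — CONSTRUCTION: families of pairs with the simultaneous double product
property (CKSU Def 4.1 = tree IsSDPP) in abelian groups of unbounded exponent meeting the packing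
bound, concretely CKSU Conj 4.7 (n pairs, |A_i||B_i| ≥ n^{2−δ}, |H| ≤ n^{2+δ}); necessary shape for
X_C by BCCGNSU Lemma 2.4, hardest and most informative (why it might fail: open since 2005 with no
candidate — the best SDPP family, CKSU Prop 4.5 in Cyc_m^{2l}, has α = log2(m−1) < β = log2 m and
bounded exponent, where Thm B forbids success; Pratt2024 Thm 4.7: Conj 4.7 forces Val(ℤ_n) ≥
n^{4/3−ε}; sources: CohnKleinbergSzegedyUmans2005 Conj 4.7 / Prop 4.5 / Prop 4.6,
BlasiakChurchCohnGrochowNaslundSawinUmans2017 Def 2.3 / Lemma 2.4 / Thm B, Pratt2024 =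
arXiv:2309.03878 Thm 4.7).
#3 CAbelianObstructionNeg — NEGATIVE side, staffed: ∃ ε > 0 uniform over ALL finite abelian H such
that every STPP construction has Σ(|A_i||B_i||C_i|)^{(2+ε)/3} ≤ |H|; literally ¬CThesis (tree:
MatrixMultiplication.GroupTheoreticSTPP.neg_crux_iff_not_thesis), i.e. BCCGNSU Thm B without the
bounded-exponent hypothesis (why it might fail: false if Conj 4.7 holds; possibly true but out of
reach — slice rank is powerless in ℤ/Nℤ (full slice rank, Behrend sets) and the skew-corner proxy
has n^{2−o(1)}-size sets, Beker2025 = arXiv:2402.19169 Thm 1; sources: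
BlasiakChurchCohnGrochowNaslundSawinUmans2017 Thm B + Sec. 1 p. 3, Pratt2024 Conj 4.1 / Thm 4.4 /
Cor 4.5).
#4 CNonabelianTPPFamilies — non-abelian version: TPP triples (G_k; S_k, T_k, U_k) (CohnUmans2003 Def
2.1 = tree RealizesTPP) with |G_k| ≤ n_k^{2+ε} and largest character degree d_max(G_k) ≤ n_k^{ε/3}
(tree maxCharDegree); decides ω = 2 through CKSU Cor 1.9 ((nmp)^{ω/3} ≤ d^{ω−2}|G|, PROVED in tree:
CKSU2005_cor19_holds); must evade arXiv:2204.03826 §3 (why it might fail: no family with α → 2 and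
d_max = |G|^{o(1)} is known or conjectured — packing-bound TPP families in print have d_max ≥ |G|^c,
Lie type is excluded (BCGPU2023 Cor 3.4), subgroup triples need |N(H_i):H_i| = |G|^{o(1)} (Thm 3.6);
sources: CohnUmans2003, CohnKleinbergSzegedyUmans2005 Cor 1.9, BlasiakCohnGrochowPrattUmans2023 Thm
3.2–3.6, arXiv:2410.14905).
Target #0 CThesis = X_C. Assembly #1 = CThesis → MatrixMultiplication (exactly the type of
`closes`). Support OmegaGeTwo (shared lower frame; proved in tree: Literature.CplxAlg.omega_ge_two).

KILL CRITERIA. CAbelianObstructionNeg proved (= ¬CThesis): the abelian line is dead → pivot the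
target to crux #4 with a new deciding theorem through CKSU2005_cor19_holds, or close
`refuted:CThesis`. A theorem that packing-bound TPP/STPP families force d_max^{ω−2} ≥ |G|^{c} in
every finite group (the common generalisation of arXiv:2204.03826 §3) closes the route outright. An
unconditional Val(ℤ_n) ≤ n^{1+o(1)} (Pratt2024 Conj 4.1) kills #2 and every abelian host with
boundedly many cyclic factors (Cor 4.5), leaving only hosts with an unbounded number of factors AND
unbounded exponent.

NOT DECOMPOSED YET. The glue from #2 to the target or to the summit: CPackingConstruction → CThesis
via the CKSU §4 construction (Â_v, B̂_v, Ĉ_v)_{v ∈ Δ_n} in H³ (before Thm 4.3; BCCGNSU2017 §2: two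
families would meet the packing bound), or CPackingConstruction → MatrixMultiplication via CKSU Thm
4.4 (abelian: Σ_i (|A_i||B_i|)^{ω/2} ≤ |H|^{3/2}, hence ω ≤ (3β−2)/α — not yet in tree, a Literature
fact to vendor) — filed as a glued split only when #2 moves. The support glue CNonabelianTPPFamilies
→ MatrixMultiplication (routine from CKSU2005_cor19_holds: M^{ω/3} ≤ M^{ε(ω−2)/3} · M^{(2+ε)/3}
gives ω − 2 ≤ ε(ω − 1) ≤ 2ε). Which abelian hosts (ℤ/Nℤ vs ℤ/p^kℤ vs many factors of growing
exponent); USP-style local constructions (CKSU §6); the continuous Lie-group analogue of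
arXiv:2204.03826 §4 / arXiv:2410.14905 (own interface + construction statement, a separate route).

CHEAPEST FALSIFIER. For any proposed witness family: compute the exponent of H — bounded exponent is
dead on arrival by the PROVED Thm B barrier
(Literature.Barriers.MatrixMultiplication.TricoloredSumFreeBarrier.not_beats_of_exponent_le /
BlasiakChurchCohnGrochowNaslundSawinUmans2017_B_holds); for the line as a whole: any proof of
Pratt2024 Conj 4.1 (Val(ℤ_n) ≤ n^{1+o(1)}), or even Val(ℤ_n) = O(n^{4/3−ε}) (Thm 4.7), refutes #2 =
CKSU Conj 4.7 at once.

Novelty: NOVELTY (retriage audit, search-before-claim: `lit search "simultaneous triple product property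
abelian group"` (12 local docs),
`lit search "skew corner-free sets"`, `lit citing arxiv:math/0511460 --since 2018` (60 works
scanned), `lit frontier MatrixMultiplication
--since 2020`, `lit bridges MatrixMultiplication --cross any`, barrier catalogue
Literature/Barriers/MatrixMultiplication/*).
Nearest prior art — the thesis X_C IS the abelian STPP programme of CohnKleinbergSzegedyUmans2005
(Thm 5.5 fundamental inequality,
Conj 4.7 "two families", Prop 4.5/4.6) as refocused by BlasiakChurchCohnGrochowNaslundSawinUmans2017
(Thm B kills bounded exponent;
Sec.1 p3: abelian groups of unbounded exponent explicitly "not ruled out"; Lemma 2.4 packing bound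
necessary) and surveyed in
BlasiakCohnGrochowPrattUmans2023 Sec.1. Post-2017 work found on the unbounded-exponent abelian case:
Pratt2024 (arXiv:2309.03878:
Val(G) hypergraph obstruction programme; Thm 4.4/Cor 4.5: w=2 from abelian groups with boundedly
many cyclic factors forces
Val(Z_n) >= n^{1+c}; Thm 4.7: Conj 4.7 forces Val(Z_n) >= n^{4/3-eps}; Conj 4.1 open) and its
aftermath PohoataZakharov
arXiv:2401.17507, Beker2025 (arXiv:2402.19169, skew-corner-free sets of size n^{2-o(1)} exist),
Jaber-Lovett-Ostuni arXiv:2404.07380,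
Milicevic arXiv:2404.07180 (quasi-polynomial upper bounds) — i.e. the planar proxies of Pratt's
obstruction are near-trivial and no
power-saving invariant for Z/NZ is known. No paper since 2018 citing CKSU2005  [refs: math/0511460, 2309.03878, 2401.17507, 2402.19169, 2404.07380, 2404.07180, 2307.06463, 2301.00074, 2410.14905, arxiv:math/0511460, CohnKleinbergSzegedyUmans2005, BlasiakChurchCohnGrochowNaslundSawinUmans2017, BlasiakCohnGrochowPrattUmans2023, Pratt2024, Beker2025]

Barriers (technique_class: group-theoretic-approach, STPP abelian unbounded-exponent): BARRIERS (catalogue Literature/Barriers/MatrixMultiplication/*; one line per catalogued barrier met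
by this technique class):
Literature.Barriers.MatrixMultiplication.TricoloredSumFreeBarrier: APPLIES to
CThesis/CPackingConstruction whenever H has bounded exponent ((Z/mZ)^n with m fixed = all
CKSU/CW-type realisations, CKSU Prop 4.5, strong USP; Thm B is PROVED in tree:
BlasiakChurchCohnGrochowNaslundSawinUmans2017_B_holds). Evasion by hypothesis, not by mechanism:
`TricoloredSumFreeBarrier.not_beats_of_exponent_le` forces witnesses for eps->0 into exponent ->
infinity (Z/NZ, Z/p^kZ with p^k growing, boundedly many cyclic factors) = the barrier's own
evasions_known (a): slice rank of M_{Z/nZ} is full (BCCGU2017 Thm B.8) and Behrend-type tricolored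
sum-free sets of size |H|^{1-o(1)} exist there. The bet is that packing-bound STPP families exist in
that regime, where print has neither construction nor obstruction (live candidate obstruction
Pratt2024 Conj 4.1 on Val(Z_n); its skew-corner proxy failed, Beker2025 Thm 1); the crux
CAbelianObstructionNeg is exactly "no evasion exists" (uniform eps over all abelian H).
Literature.Barriers.MatrixMultiplication.EquivoluminousBarrier: does not bite — the route never uses
the CW 1990 Sec.11 "no three disjoint equivoluminous subsets" hypothesis (already vacuous by
NaslundSawin2017 Thm 3); recorded as a warning that USP/CW-style local combinatorial hypotheses in
bounded-exponent groups fall to sunflower/slice-rank bounds, which is why CPa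

History (route lifecycle, newest last):
- 2026-08-15T16:16:30Z · rev 3: restated Assembly (stmt-MatrixMultiplication-0594) — route-repair (glue): deciding theorem closes : CThesis → MatrixMultiplication PROVED from tree theorems (CohnKleinbergSzegedyUmans2005_5_5_abelian_holds with ep (planner-rbadge-MatrixMultiplication-GroupTheor-f87adc36-g2-0)

sub-problem: MatrixMultiplication · status: done · opened planner-MatrixMultiplication-Survey-0 2026-08-13T13:19:20Z · rev 3 · ledger route-MatrixMultiplication-GroupTheoreticSTPP
GENERATED by the gate from the ledger (D-0016/17). Provers cite these decls: `theorem foo : Summit.MatrixMultiplication.MatrixMultiplication.Theses.GroupTheoreticSTPP.<Decl> := …` in Summits/MatrixMultiplication/MatrixMultiplication/Theorems/<Name>.lean.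
-/

namespace Summit.MatrixMultiplication.MatrixMultiplication.Theses.GroupTheoreticSTPP

open scoped BigOperators Topology Manifold Classical MeasureTheory ProbabilityTheory Matrix InnerProductSpace ComplexConjugate ContinuousMap
open Filter Set Function TopologicalSpace MeasureTheory

attribute [summit_statement] _root_.MatrixMultiplication

/-- item stmt-MatrixMultiplication-0593 · target · rank 0 · open · by planner
why it might fail: May be false: Thm B (proved in tree) bars every bounded-exponent H; no abelian STPP family meeting the necessary packing bound (Lemma 2.4) is known; sibling Conj 3.4 died to slice rank; Pratt2024 Conj 4.1 (Val(Z_n)<=n^{1+eps}, open) would bar all H with boundedly many cyclic factors (Cor 4.5).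
sources: BlasiakChurchCohnGrochowNaslundSawinUmans2017 Thm A, Thm B, Lemma 2.4, Sec.1 p3, CohnKleinbergSzegedyUmans2005 Conj 4.7, Thm 5.5, Pratt2024 (arXiv:2309.03878) Conj 4.1, Thm 4.4, Cor 4.5, lean:Literature.Computability.AlgebraicComplexity.BlasiakChurchCohnGrochowNaslundSawinUmans2017_B_holds, lean:Literature.Barriers.MatrixMultiplication.TricoloredSumFreeBarrier.not_beats_of_exponent_le, lean:MatrixMultiplication.GroupTheoreticSTPP.neg_crux_iff_not_thesis
X_C: for every ε>0 there is a finite abelian group H and an STPP construction (A_i,B_i,C_i)_{i<N}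
(CKSU2005 Def 5.1 / BCCGNSU2017 Def 2.2, additive form) with Σ_i (|A_i||B_i||C_i|)^{(2+ε)/3} > |H|. -/
@[route_item "route-MatrixMultiplication-GroupTheoreticSTPP", crux]
def CThesis : Prop :=
  ∀ ε : ℝ, 0 < ε → ∃ (H : Type) (_ : AddCommGroup H) (_ : Fintype H) (N : ℕ) (A B C : Fin N → Finset H), (∀ i j k : Fin N, ∀ s ∈ A k, ∀ s' ∈ A i, ∀ t ∈ B i, ∀ t' ∈ B j, ∀ u ∈ C j, ∀ u' ∈ C k, (s' - s) + (t' - t) + (u' - u) = 0 → i = j ∧ j = k ∧ s = s' ∧ t = t' ∧ u = u') ∧ (Fintype.card H : ℝ) < ∑ i, (((A i).card * (B i).card * (C i).card : ℕ) : ℝ) ^ ((2 + ε) / 3)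

/-- item stmt-MatrixMultiplication-0595 · crux · rank 2 · open · by planner
why it might fail: = CKSU Conj 4.7, open since 2005, no candidate: best SDPP family (CKSU Prop 4.5, Cyc_m^{2l}) has alpha=log2(m-1)<beta=log2 m and bounded exponent, where Thm B forbids success; Pratt2024 Thm 4.7: Conj 4.7 forces Val(Z_n)>=n^{4/3-eps}, so any bound Val(Z_n)=O(n^{4/3-eps}) refutes it.
sources: CohnKleinbergSzegedyUmans2005 Conj 4.7, Prop 4.5, Prop 4.6, Def 4.1, BlasiakChurchCohnGrochowNaslundSawinUmans2017 Thm B, Def 2.3, Lemma 2.4, Sec.2 p5-6 (two-families would meet the packing bound; need not have bounded exponent), Pratt2024 (arXiv:2309.03878) Thm 4.7, Conj 4.1, Conj 2.5, Beker2025 (arXiv:2402.19169) Thm 1 (skew-corner proxy for such a Val bound is dead: s(n)=n^{2-o(1)}), lean:Literature.Computability.AlgebraicComplexity.IsSTPP.sum_rpow_le_card_of_packing_defect, lean:Literature.Computability.AlgebraicComplexity.BlasiakChurchCohnGrochowNaslundSawinUmans2017_B_holds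
CONSTRUCTION crux: a family of STPP constructions in finite abelian groups H of unbounded exponent
(e.g. cyclic ℤ/Nℤ or (ℤ/p^kℤ)^m with p^k → ∞) meeting the packing bound of BCCGNSU2017 Def 2.3
(Σ_i|A_i||B_i| ≥ |H|^{1−o(1)} and cyclically) with uniform sizes |A_i|=|B_i|=|C_i| = m → ∞;
concretely CKSU2005 Conjecture 4.7 (two families with the simultaneous double product property).
Necessary for X_C by BCCGNSU Lemma 2.4; no packing-bound family is known in any group
(arXiv:2204.03826 p3). -/
@[route_item "route-MatrixMultiplication-GroupTheoreticSTPP"]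
def CPackingConstruction : Prop :=
  ∀ δ : ℝ, 0 < δ → ∀ n₀ : ℕ, ∃ n ≥ n₀, ∃ (H : Type) (_ : AddCommGroup H) (_ : Fintype H) (A B : Fin n → Finset H), (∀ i : Fin n, ∀ a ∈ A i, ∀ a' ∈ A i, ∀ b ∈ B i, ∀ b' ∈ B i, (a - a') + (b - b') = 0 → a = a' ∧ b = b') ∧ (∀ i j k : Fin n, ∀ a ∈ A i, ∀ a' ∈ A j, ∀ b ∈ B j, ∀ b' ∈ B k, (a - a') + (b - b') = 0 → i = k) ∧ (Fintype.card H : ℝ) ≤ (n : ℝ) ^ (2 + δ) ∧ ∀ i : Fin n, (n : ℝ) ^ (2 - δ) ≤ (((A i).card * (B i).card : ℕ) : ℝ)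

/-- item stmt-MatrixMultiplication-0596 · crux · rank 3 · open · by planner
why it might fail: = not-X_C with eps UNIFORM over all abelian H, stronger than print (Thm B: eps_l per exponent l); false if CKSU Conj 4.7 holds; maybe true but out of reach: slice rank is powerless in Z/NZ (full slice rank, BCCGU Thm B.8; Behrend) and the skew-corner proxy has n^{2-o(1)}-size sets (Beker2025).
sources: BlasiakChurchCohnGrochowNaslundSawinUmans2017 Thm B, Sec.1 p3 ('do not rule out ... abelian groups of unbounded exponent'), BlasiakChurchCohnGrochowUmans2017 Thm B.8 (cyclic groups have full slice rank), Pratt2024 (arXiv:2309.03878) Conj 4.1, Thm 4.4, Cor 4.5, Beker2025 (arXiv:2402.19169) Thm 1, Thm 2, arXiv:2404.07380 (Jaber-Lovett-Ostuni) Thm 1.1: only quasi-polynomial savings for skew corners, lean:MatrixMultiplication.GroupTheoreticSTPP.neg_crux_iff_not_thesis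
NEGATIVE crux (¬X_C, effective): there is ε>0 such that for every finite abelian group H and every
STPP construction (A_i,B_i,C_i)_{i<N} in H, Σ_i (|A_i||B_i||C_i|)^{(2+ε)/3} ≤ |H| — i.e. BCCGNSU2017
Thm B without the bounded-exponent hypothesis. Proving it kills the abelian group-theoretic
approach; slice rank alone cannot (Behrend sets in ℤ/Nℤ). -/
@[route_item "route-MatrixMultiplication-GroupTheoreticSTPP"]
def CAbelianObstructionNeg : Prop :=
  ∃ ε : ℝ, 0 < ε ∧ ∀ (H : Type) [AddCommGroup H] [Fintype H] (N : ℕ) (A B C : Fin N → Finset H), (∀ i j k : Fin N, ∀ s ∈ A k, ∀ s' ∈ A i, ∀ t ∈ B i, ∀ t' ∈ B j, ∀ u ∈ C j, ∀ u' ∈ C k, (s' - s) + (t' - t) + (u' - u) = 0 → i = j ∧ j = k ∧ s = s' ∧ t = t' ∧ u = u') → ∑ i, (((A i).card * (B i).card * (C i).card : ℕ) : ℝ) ^ ((2 + ε) / 3) ≤ (Fintype.card H : ℝ)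

/-- item stmt-MatrixMultiplication-0597 · crux · rank 4 · open · by planner
why it might fail: Needs alpha(G_k)->2 with d_max=|G_k|^{o(1)}; no such family known or conjectured: packing-bound TPP families in print (S_{n(n+1)/2}, wreath; CU03 Thm 3.3, Sec.7) have d_max>=|G|^c; Lie type excluded (BCGPU2023 Cor 3.4); subgroup triples need |Z(G)|,|N(H_i):H_i|=|G|^{o(1)} (Thm 3.6/Cor 3.8).
sources: CohnUmans2003 Def 2.1, Lemma 3.1 (abelian alpha=3), Thm 3.3, Cor 4.3, Sec.7, CohnKleinbergSzegedyUmans2005 Cor 1.9 ((nmp)^{w/3} <= d^{w-2}|G|), BlasiakCohnGrochowPrattUmans2023 (arXiv:2204.03826) Thm 3.2, Cor 3.3-3.5, Thm 3.6, Cor 3.8, Sec.1.1 p4 ('important challenge'), BlasiakChurchCohnGrochowUmans2017 Prop 2.4, Thm 4.2, Thm 3.19/Cor 3.20, Sawin2018 Thm 1.5, arXiv:2410.14905 (BCGPU 2024: favourable constructions moved to infinite Lie groups, provably impossible in finite Lie type)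
Non-abelian version: there are finite groups G_k with subsets S_k,T_k,U_k satisfying the triple
product property (CohnUmans2003 Def 2.1), n_k := (|S_k||T_k||U_k|)^{1/3} → ∞, |G_k| ≤ n_k^{2+ε_k}
and largest irreducible character degree d_max(G_k) ≤ n_k^{ε_k} with ε_k → 0; by CKSU2005 Cor 1.9
((nmp)^{ω/3} ≤ d^{ω−2}|G|) this gives ω = 2. Must evade BlasiakCohnGrochowPrattUmans2023 §3 (no Lie
type; no subgroups with large normalisers, Thm 3.6). Needs TripleProductProperty + maxCharDegree
definitions. -/
@[route_item "route-MatrixMultiplication-GroupTheoreticSTPP", crux]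
def CNonabelianTPPFamilies : Prop :=
  ∀ ε : ℝ, 0 < ε → ∀ n₀ : ℕ, ∃ (G : Type) (_ : Group G) (_ : Fintype G) (S T U : Finset G), (∀ s ∈ S, ∀ s' ∈ S, ∀ t ∈ T, ∀ t' ∈ T, ∀ u ∈ U, ∀ u' ∈ U, (s * s'⁻¹) * (t * t'⁻¹) * (u * u'⁻¹) = 1 → s = s' ∧ t = t' ∧ u = u') ∧ (n₀ : ℝ) ≤ ((S.card * T.card * U.card : ℕ) : ℝ) ∧ (Fintype.card G : ℝ) ≤ ((S.card * T.card * U.card : ℕ) : ℝ) ^ ((2 + ε) / 3) ∧ (Literature.RepresentationTheory.FiniteGroups.maxCharDegree G : ℝ) ≤ ((S.card * T.card * U.card : ℕ) : ℝ) ^ (ε / 3)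

/-- item stmt-MatrixMultiplication-0586 · support · rank 5 · closed · proved by Summit.MatrixMultiplication.MatrixMultiplication.Theorems.omegaGeTwo_proof @ cbdcc04c67d9 (prover) · by planner
sources: Blaser2013 Sec.5-6, lean:Literature.CplxAlg.omega_ge_two, lean:Literature.CplxAlg.two_le_omega
Lower frame shared by all positive routes: admissibleExponents ℂ is bounded below and 2 ≤ ω(ℂ), from
the flattening bound R(<n,n,n>) ≥ n^2 (Blaser2013 §5–6; BurgisserClausenShokrollahi1997 (15.?)
conciseness) and n^2 = O(n^β) ⇒ β ≥ 2. -/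
@[route_item "route-MatrixMultiplication-GroupTheoreticSTPP"]
def OmegaGeTwo : Prop :=
  BddBelow (Literature.Computability.AlgebraicComplexity.admissibleExponents ℂ) ∧ 2 ≤ Literature.Computability.AlgebraicComplexity.omega ℂ

-- earlier Assembly (stmt-MatrixMultiplication-0594, replaced 2026-08-15T16:16:30Z -> stmt-MatrixMultiplication-10468): retired by None — (∀ ε : ℝ, 0 < ε → ∃ (H : Type) (_ : AddCommGroup H) (_ : Fintype H) (N : ℕ) (A B C : Fin N → Finset H), (∀ i j k : Fin N, ∀ s ∈ A k, ∀ s' ∈ A i, ∀ t ∈ B i, ∀ t' ∈ B j, ∀ u ∈ C j, ∀ u' ∈ C k, (s' - s) + (t' - t) + (u' - u) = 0 → i = j ∧ j = k ∧ s = s' ∧ t = t' ∧ u =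
/-- item stmt-MatrixMultiplication-10468 · assembly · rank 1 · open · by planner
[assembly] CThesis → MatrixMultiplication: the target X_C alone decides ω(ℂ) = 2 — exactly the type
of the deciding theorem `closes`, which is PROVED in this file from CKSU 2005 Thm 5.5 (abelian case,
tree theorem CohnKleinbergSzegedyUmans2005_5_5_abelian_holds) with ε := ω − 2 and ω ≥ 2
(omega_two_le). Replaces stmt-MatrixMultiplication-0594, whose hypothesis inlined the text of
CThesis instead of naming the item (gate code glue.extra-hypothesis). -/
@[route_item "route-MatrixMultiplication-GroupTheoreticSTPP"]
def Assembly : Prop :=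
  CThesis → MatrixMultiplication

/-! D-0027 §2.1 — DECIDING THEOREM (planner-authored via `route open/edit --closes-file`; by planner-rbadge-MatrixMultiplication-GroupTheor-f87adc36-g2-0 2026-08-15T16:16:30Z):
its hypotheses are this route's items and its conclusion the sub-problem Statement (glue_lint), and it elaborates with this file. -/

/-- DECIDING THEOREM (D-0027 §2.1): the target `CThesis` (X_C) alone decides `ω(ℂ) = 2`.
`ω ≥ 2` is the flattening bound (`omega_two_le`, PROVED in tree); if `ω > 2`, apply X_C with
`ε := ω − 2` to get an abelian STPP construction with `|H| < Σᵢ (|Aᵢ||Bᵢ||Cᵢ|)^{ω/3}`, contradicting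
the fundamental inequality of Cohn–Kleinberg–Szegedy–Umans 2005, Thm. 5.5 (abelian case), PROVED in
tree as `CohnKleinbergSzegedyUmans2005_5_5_abelian_holds` (via Schönhage's asymptotic sum inequality).
No Literature fact is assumed; the cruxes `CPackingConstruction` (CKSU Conj. 4.7) and
`CNonabelianTPPFamilies` are the two construction programmes feeding X_C resp. CKSU Cor. 1.9, and
`CAbelianObstructionNeg = ¬ CThesis` is the staffed negative side. -/
@[closes "route-MatrixMultiplication-GroupTheoreticSTPP"] theorem closes (hC : CThesis) : MatrixMultiplication := by
  rw [MatrixMultiplication_iff]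
  by_contra hne
  have h2 : (2 : ℝ) < Literature.Computability.AlgebraicComplexity.omega ℂ :=
    lt_of_le_of_ne (Literature.Computability.AlgebraicComplexity.omega_two_le ℂ) (Ne.symm hne)
  obtain ⟨H, _, _, N, A, B, C, hS, hlt⟩ :=
    hC (Literature.Computability.AlgebraicComplexity.omega ℂ - 2) (sub_pos.mpr h2)
  have hle : ∑ i, (((A i).card * (B i).card * (C i).card : ℕ) : ℝ) ^
      (Literature.Computability.AlgebraicComplexity.omega ℂ / 3) ≤ (Fintype.card H : ℝ) :=
    Literature.Computability.AlgebraicComplexity.CohnKleinbergSzegedyUmans2005_5_5_abelian_holds H N A B C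
      ((Literature.Computability.AlgebraicComplexity.isSTPP_iff A B C).2 hS)
  rw [show (2 + (Literature.Computability.AlgebraicComplexity.omega ℂ - 2)) / 3 =
      Literature.Computability.AlgebraicComplexity.omega ℂ / 3 by ring] at hlt
  exact lt_irrefl _ (hlt.trans_le hle)

end Summit.MatrixMultiplication.MatrixMultiplication.Theses.GroupTheoreticSTPP
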